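import Summits.CriticalPhenomena.CardyFormulaZ2.Theorems.CardyTensorRGPolyominoGaussianLawUniversalLaw

/-!
# Strategy census — typed companion (crux-strategist s1, stmt-CriticalPhenomena-14337)

Crux: `Summit.CriticalPhenomena.CardyFormulaZ2.Theses.CardyTensorRG.PolyominoGaussianLaw`
(route `CardyTensorRG`; live line `Lines/birth.lean`, open stubs `E = stub_dyadicLimitExists`,
`I = stub_dyadicLimitIsBetaLaw`).

This file types the signatures tried in `STRATEGY-CENSUS.md` under **Strengthen** and
**Decomposition** and proves the elementary implications between them, so that the census can point
at WHERE the content sits.  Nothing below is a line of attack: every proposition that is not proved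
here is either the live line's open stub `E`, another open route's load-bearing crux, or the crux minus
bookkeeping (verdicts in the census).  No `sorry`.

* `polyominoGaussianLaw_iff`                      crux ↔ ∃ a ∈ (0,1), PolyLawAt a            (bookkeeping)
* `universal_of_polyominoGaussianLaw`             crux → U                                     (b1: U is crux-minus-shape)
* `polyominoGaussianLaw_of_universal_of_rigidity` U → CardyRigidity → crux                    (b1 glue, from the landed
                                                   `Birth.polyominoGaussianLaw_of_universalLaw`)
* `polyominoGaussianLaw_of_rect_of_words`         Rect → Words → crux                           (b4 glue)
* `rectCornerLaw_of_polyominoGaussianLaw`         crux → Rect                                   (b4: Rect is a sub-case)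
* `dyadicLimitExists_of_eventuallyMonotone`       S⁺_mono → E                                   (strengthen 1)
* `dyadicLimitExists_of_geometricCauchy`          S⁺_rate → E                                   (strengthen 2)
* `not_cardyFormulaZ2_of_not_crux`                ¬crux → ¬CardyFormulaZ2                        (negation = ¬S, landed)
-/

open Filter Topology Set

namespace Summit.CriticalPhenomena.CardyFormulaZ2.Cruxes.PolyominoGaussianLaw.StrategyCensus

open Literature.Probability.RandomPlanarGeometry (ConformalRectangle crossRatio)
open Literature.Probability.Percolation (bondDomainCrossingProb bondDomainCrossingProb_mem_Icc)
open Summit.CriticalPhenomena.CardyFormulaZ2.Theses.CardyTensorRG (PolyominoGaussianLaw CardyRigidity)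
open Summit.CriticalPhenomena.CardyFormulaZ2.Cruxes.PolyominoGaussianLaw.Birth
  (polyominoGaussianLaw_of_universalLaw continuousOn_betaLaw not_cardyFormulaZ2_of_not)

/-- `R` is a polyomino conformal rectangle represented at lattice scale `δ₀` with lattice marks
(verbatim the crux's class). -/
def IsPolyRep (R : ConformalRectangle) (δ₀ : ℝ) : Prop :=
  (∃ s : Finset (ℤ × ℤ), R.carrier = interior (⋃ p ∈ s, {z : ℂ | δ₀ * (p.1 : ℝ) ≤ z.re ∧
      z.re ≤ δ₀ * ((p.1 : ℝ) + 1) ∧ δ₀ * (p.2 : ℝ) ≤ z.im ∧ z.im ≤ δ₀ * ((p.2 : ℝ) + 1)})) ∧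
  ∀ i, ∃ m n : ℤ, R.pt i = (δ₀ : ℂ) * ((m : ℂ) + (n : ℂ) * Complex.I)

/-- The normalised incomplete symmetric beta law `I_a(η) = ∫₀^η (s(1-s))^{-a} / ∫₀¹ (s(1-s))^{-a}`. -/
noncomputable def betaLaw (a : ℝ) (η : ℝ) : ℝ :=
  intervalIntegral (fun s : ℝ => (s * (1 - s)) ^ (-a)) 0 η MeasureTheory.volume /
    intervalIntegral (fun s : ℝ => (s * (1 - s)) ^ (-a)) 0 1 MeasureTheory.volume

/-- The crux at a FIXED exponent `a`. -/
def PolyLawAt (a : ℝ) : Prop :=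
  ∀ R : ConformalRectangle, (∃ δ₀ : ℝ, 0 < δ₀ ∧ IsPolyRep R δ₀) →
    R.HasCrossingLimit (bondDomainCrossingProb R) (betaLaw a)

/-- Bookkeeping: the crux is `∃ a ∈ (0,1), PolyLawAt a` (definitionally). -/
theorem polyominoGaussianLaw_iff :
    PolyominoGaussianLaw ↔ ∃ a : ℝ, a ∈ Set.Ioo (0 : ℝ) 1 ∧ PolyLawAt a :=
  Iff.rfl

/-! ## Decomposition (b1): shape-free universal law `U` ∧ `CardyRigidity` -/

/-- Piece `U`: ONE continuous law `F` on `(0,1)` for every polyomino conformal rectangle with lattice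
marks (no beta shape, no exponent). -/
def UniversalPolyominoLaw : Prop :=
  ∃ F : ℝ → ℝ, ContinuousOn F (Set.Ioo 0 1) ∧
    ∀ R : ConformalRectangle, (∃ δ₀ : ℝ, 0 < δ₀ ∧ IsPolyRep R δ₀) →
      R.HasCrossingLimit (bondDomainCrossingProb R) F

/-- (b1) `U` is implied by the crux outright: it is the crux minus the beta shape. -/
theorem universal_of_polyominoGaussianLaw : PolyominoGaussianLaw → UniversalPolyominoLaw := by
  rintro ⟨a, ha, hpoly⟩
  exact ⟨_, continuousOn_betaLaw ha.2, hpoly⟩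

/-- (b1) glue, proved from the landed `Birth.polyominoGaussianLaw_of_universalLaw`:
`U → CardyRigidity → crux` (CardyRigidity = stmt-CriticalPhenomena-0746, already a binder of `closes`). -/
theorem polyominoGaussianLaw_of_universal_of_rigidity :
    UniversalPolyominoLaw → CardyRigidity → PolyominoGaussianLaw := by
  rintro ⟨F, hF, hpoly⟩ hRig
  exact polyominoGaussianLaw_of_universalLaw hRig hF hpoly

/-! ## Decomposition (b4): corner-marked lattice rectangles (tensor-RG native) ∧ word extension -/

/-- `R` is a polyomino representation at scale `δ₀` whose carrier is the open lattice rectangle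
`(0, δ₀ m) × (0, δ₀ n)` and whose four marks are its four corners (the open networks of
`Literature.MathematicalPhysics.StatisticalMechanics.TensorRGBoundaryMap.rectPartition`). -/
def IsCornerRect (R : ConformalRectangle) (δ₀ : ℝ) : Prop :=
  IsPolyRep R δ₀ ∧ ∃ m n : ℕ, 0 < m ∧ 0 < n ∧
    R.carrier = {z : ℂ | 0 < z.re ∧ z.re < δ₀ * m ∧ 0 < z.im ∧ z.im < δ₀ * n} ∧
    ∀ i, R.pt i ∈ ({(0 : ℂ), ((δ₀ * m : ℝ) : ℂ), ((δ₀ * m : ℝ) : ℂ) + ((δ₀ * n : ℝ) : ℂ) * Complex.I,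
      ((δ₀ * n : ℝ) : ℂ) * Complex.I} : Set ℂ)

/-- The crux at exponent `a` restricted to corner-marked lattice rectangles. -/
def RectLawAt (a : ℝ) : Prop :=
  ∀ R : ConformalRectangle, (∃ δ₀ : ℝ, 0 < δ₀ ∧ IsCornerRect R δ₀) →
    R.HasCrossingLimit (bondDomainCrossingProb R) (betaLaw a)

/-- Piece `Rect`: one exponent for all corner-marked lattice rectangles. -/
def RectCornerLaw : Prop := ∃ a : ℝ, a ∈ Set.Ioo (0 : ℝ) 1 ∧ RectLawAt a

/-- Piece `Words`: rectangle-to-polyomino extension at every exponent (the Temperley–Lieb word /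
seam-gluing content of routes `CardyPolygonWords`, `CardyGluingRDE`). -/
def WordExtension : Prop := ∀ a : ℝ, a ∈ Set.Ioo (0 : ℝ) 1 → RectLawAt a → PolyLawAt a

/-- (b4) glue: `Rect → Words → crux`. -/
theorem polyominoGaussianLaw_of_rect_of_words : RectCornerLaw → WordExtension → PolyominoGaussianLaw := by
  rintro ⟨a, ha, hrect⟩ hW
  exact ⟨a, ha, hW a ha hrect⟩

/-- (b4) `Rect` is a sub-case of the crux. -/
theorem rectCornerLaw_of_polyominoGaussianLaw : PolyominoGaussianLaw → RectCornerLaw := by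
  rintro ⟨a, ha, hpoly⟩
  exact ⟨a, ha, fun R ⟨δ₀, hδ₀, hC⟩ => hpoly R ⟨δ₀, hδ₀, hC.1⟩⟩

/-! ## Strengthen: rigid forms that would give the open stub `E` -/

/-- The live line's open stub `E` (verbatim `Birth.Stubs.stub_dyadicLimitExists`): dyadic orbit limits
exist for every polyomino representation with lattice marks. -/
def DyadicLimitExists : Prop :=
  ∀ R : ConformalRectangle, ∀ δ₀ : ℝ, 0 < δ₀ →
    (∃ s : Finset (ℤ × ℤ), R.carrier = interior (⋃ p ∈ s, {z : ℂ | δ₀ * (p.1 : ℝ) ≤ z.re ∧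
      z.re ≤ δ₀ * ((p.1 : ℝ) + 1) ∧ δ₀ * (p.2 : ℝ) ≤ z.im ∧ z.im ≤ δ₀ * ((p.2 : ℝ) + 1)})) →
    (∀ i, ∃ m n : ℤ, R.pt i = (δ₀ : ℂ) * ((m : ℂ) + (n : ℂ) * Complex.I)) →
    ∃ L : ℝ, Tendsto (fun k : ℕ => bondDomainCrossingProb R (δ₀ / 2 ^ k)) atTop (𝓝 L)

/-- S⁺_mono: along every dyadic orbit the crossing probabilities are EVENTUALLY monotone (the
monotone-approach lever of routes `CardyMonotoneApproach` / `CardyOrderDuality` / `CardySelfRefinement`,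
here only along `δ₀ 2^{-k}`). -/
def EventuallyMonotoneOrbits : Prop :=
  ∀ R : ConformalRectangle, ∀ δ₀ : ℝ, 0 < δ₀ → IsPolyRep R δ₀ →
    ∃ k₀ : ℕ, Monotone (fun k : ℕ => bondDomainCrossingProb R (δ₀ / 2 ^ (k + k₀))) ∨
      Antitone (fun k : ℕ => bondDomainCrossingProb R (δ₀ / 2 ^ (k + k₀)))

/-- Strengthen 1: eventual monotonicity gives `E` by bounded monotone convergence (`P ∈ [0,1]`). -/
theorem dyadicLimitExists_of_eventuallyMonotone : EventuallyMonotoneOrbits → DyadicLimitExists := by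
  intro h R δ₀ hδ₀ hs hmarks
  obtain ⟨k₀, hmono⟩ := h R δ₀ hδ₀ ⟨hs, hmarks⟩
  have hbddA : BddAbove (Set.range fun k : ℕ => bondDomainCrossingProb R (δ₀ / 2 ^ (k + k₀))) := by
    refine ⟨1, ?_⟩
    rintro _ ⟨k, rfl⟩
    exact (bondDomainCrossingProb_mem_Icc R _).2
  have hbddB : BddBelow (Set.range fun k : ℕ => bondDomainCrossingProb R (δ₀ / 2 ^ (k + k₀))) := by
    refine ⟨0, ?_⟩
    rintro _ ⟨k, rfl⟩
    exact (bondDomainCrossingProb_mem_Icc R _).1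
  rcases hmono with hm | ha
  · exact ⟨_, (Filter.tendsto_add_atTop_iff_nat
      (f := fun j : ℕ => bondDomainCrossingProb R (δ₀ / 2 ^ j)) k₀).1 (tendsto_atTop_ciSup hm hbddA)⟩
  · exact ⟨_, (Filter.tendsto_add_atTop_iff_nat
      (f := fun j : ℕ => bondDomainCrossingProb R (δ₀ / 2 ^ j)) k₀).1 (tendsto_atTop_ciInf ha hbddB)⟩

/-- S⁺_rate: geometric decay of consecutive dyadic differences with SOME ratio `θ < 1` (the output a
hyperbolic / contracting blocking step would give: `DyadicContraction`, stmt-CriticalPhenomena-6695, and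
the saddle certificate stmt-CriticalPhenomena-13817). -/
def GeometricCauchyOrbits : Prop :=
  ∃ θ : ℝ, θ < 1 ∧ ∀ R : ConformalRectangle, ∀ δ₀ : ℝ, 0 < δ₀ → IsPolyRep R δ₀ →
    ∃ C : ℝ, ∀ k : ℕ, dist (bondDomainCrossingProb R (δ₀ / 2 ^ k))
      (bondDomainCrossingProb R (δ₀ / 2 ^ (k + 1))) ≤ C * θ ^ k

/-- Strengthen 2: geometric Cauchy control gives `E` (completeness of `ℝ`). -/
theorem dyadicLimitExists_of_geometricCauchy : GeometricCauchyOrbits → DyadicLimitExists := by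
  rintro ⟨θ, hθ, h⟩ R δ₀ hδ₀ hs hmarks
  obtain ⟨C, hC⟩ := h R δ₀ hδ₀ ⟨hs, hmarks⟩
  exact cauchySeq_tendsto_of_complete (cauchySeq_of_le_geometric θ C hθ hC)

/-! ## Negation: the crux is irrefutable short of refuting the sub-problem -/

/-- A refutation of the crux refutes `CardyFormulaZ2` as typed (landed: `Birth.not_cardyFormulaZ2_of_not`). -/
theorem not_cardyFormulaZ2_of_not_crux :
    ¬ PolyominoGaussianLaw → ¬ Literature.Probability.Percolation.CardyFormulaZ2 :=
  not_cardyFormulaZ2_of_not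

end Summit.CriticalPhenomena.CardyFormulaZ2.Cruxes.PolyominoGaussianLaw.StrategyCensus
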